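import Literature.Computability.AlgebraicComplexity.MS21DenseOrbitsHittingSets
import HarnessLib

/-!
# Hitting sets for orbits of circuit classes (Saha–Thankey 2021, §1.1–§1.2: Defs 1–5, Thms 6–10)

C. Saha, B. Thankey, *Hitting sets for orbits of circuit classes and polynomial families*,
APPROX/RANDOM 2021, LIPIcs 207, Art. 50, doi:10.4230/LIPIcs.APPROX/RANDOM.2021.50
[SahaThankey2021] (full version: ECCC TR21-015). Held text: the LIPIcs open-access PDF
(`lit read` of the Dagstuhl URL → `paper:url-9948e557089c`, page `50:N` = file `p00NN.txt`); the
LIPIcs numbering is used throughout (Defs 1–5 p. 50:3–4, Thm 6 p. 50:4 L18, Thm 7 p. 50:4 L35,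
Thm 8 p. 50:4 L45, Thm 9 p. 50:5 L9, Thm 10 p. 50:5 L27). Typed literature for the cell `val-lit`
(cross-ladder typing seat x3, row X3-ST21; rung V4 — hitting sets for ORBITS of small classes, the
orbit(-closure) idiom of succinct hitting sets, N1/N5). HONEST FRAMING: cite-tagged statements of
published results; typed ≠ proved ≠ endorsed; `VP ≠ VNP` is NOT proved and nothing here bears on it.

## Rendering (read by referees)

* Def. 4 "the orbit of `f` is `{f(Ax) : A ∈ GL(n,F)}`; the orbit of a set `C` is the union of the
  orbits" → `SahaThankey2021.orb C := ⋃ f ∈ C, MS2021.linOrbit n f` (the tree's `f^{GL_n(F)}`,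
  `MS21DenseOrbitsHittingSets.lean`, `x_i ↦ (Ax)_i` literally; CITED, not re-typed).
* Def. 5 hitting set → the tree's `HittingSets.IsHittingSetFor` (`GKSS19HardnessToHittingSets.lean`).
* Def. 1 (ROABP) / Def. 2 (commutative ROABP) are typed AS PRINTED here (`SahaThankey2021.IsROABP`,
  `IsCommutativeROABP`: `f = 1ᵀ M₁(x₁)⋯M_n(x_n) 1`, entries of `Mᵢ` univariate in `xᵢ`, and for Def. 2
  the `Mᵢ` pairwise COMMUTE) and NOT identified with the tree's `IsROABP`/`IsCommROABP` of
  `FSV18SuccinctGenerators.lean` (FSV's "commutative" = computable in EVERY variable order, a priori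
  weaker than pairwise commuting layers; FSV's width-`w` roABP carries an individual-degree parameter
  and outputs a matrix entry). Def. 1 fixes the order `x₁,…,x_n`; since the theorems are about ORBITS
  (closed under permutation matrices) this is immaterial.
* Def. 3 (occur-`k` formulas) → the inductive `SahaThankey2021.Formula` (leaves = polynomials,
  `+` gates with field-element edge labels, `×⋏` gates with natural-number edge weights) with
  `eval`, `depth` (= tree depth `+ 2`, a leaf having tree depth `0`), `size` (weighted edge count plus,
  for each leaf, the size `s·(d+1)` of a depth-2 circuit for an `s`-sparse degree-`d` polynomial —
  the printed "sizes of the depth-2 circuits computing the sparse polynomials"; any other polynomially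
  related convention changes only the constants inside the printed `O(·)`), `occur i` (number of
  leaves whose polynomial involves `xᵢ`).
* "a hitting set for `orb(C)` can be computed in `T` time" is an ALGORITHMIC claim; typed is the
  EXISTENCE of a hitting set of SIZE `≤ T` (explicitness dropped — WEAKER, as in the cell's MS21/KV20
  files), with ONE absolute constant `c` for each printed `O(·)`; an exponent `O(g)` is rendered
  `c·(g + 1)` (resp. with `⌊log₂ ·⌋ + 1` for printed logarithms) and `+ c` is added to the bound, so
  that degenerate parameter values (`w = 1`, `n·d ≤ 1`) do not falsify the sentence. Field-size
  clauses "`|F| > B`" are typed `Infinite F ∨ B < Nat.card F`; "`char(F) = 0` or `> B`" is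
  `ringChar F = 0 ∨ B < ringChar F`. Classes "computable by width-`w` … of size `s`, depth `Δ`" are
  typed with `≤` (monotone in the parameters; the hitting-set claims are unchanged).
* Thm. 7 is QUOTED by the paper from Medini–Shpilka [51]; it is the tree's `MS2021_cor_44` (x6's file)
  — CITED in the docstring of Thm. 10, not re-typed (dedup).

## Coverage (source item → declaration → status), faithfulness sheet

* Def. 1 → `SahaThankey2021.IsROABP` DEF; Def. 2 → `IsCommutativeROABP` DEF; Def. 3 → `Formula`,
  `Formula.eval/depth/size/occur` DEFS; Def. 4 → `orb` DEF (over `MS2021.linOrbit`); Def. 5 → CITE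
  `HittingSets.IsHittingSetFor`.
* **Thm. 6** (p. 50:4 L18) → `sahaThankey2021_thm_6` FACT — WEAKER (existence/size for time).
* **Thm. 7** (p. 50:4 L35, = [MS21]) → CITE `MS2021_cor_44` (not re-typed).
* **Thm. 8** (p. 50:4 L45) → `sahaThankey2021_thm_8` FACT — WEAKER (existence/size for time).
* **Thm. 9** (p. 50:5 L9; `R := (2k)^{2Δ·2^Δ}`) → `sahaThankey2021_thm_9` FACT — WEAKER (idem); both
  printed bounds (general, and `b`-variate leaves) typed; the "in particular" sentence is a
  specialization, not typed separately.
* **Thm. 10** (p. 50:5 L27) → `sahaThankey2021_thm_10` FACT — WEAKER (idem); both bounds typed.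
* §1 prose corollaries (elementary symmetric / `IMM_{3,d}` / power symmetric / sum-product
  polynomials, depth-4 multilinear circuits) and §1.3–§1.4 (techniques, prior work) — NOT TYPED.

## References

* C. Saha, B. Thankey, APPROX/RANDOM 2021, LIPIcs 207:50. [SahaThankey2021]
* D. Medini, A. Shpilka, CCC 2021 (the paper's [51]; tree `MS2021_cor_44`). [MediniShpilka2021]
-/

noncomputable section

open MvPolynomial

namespace Literature.Computability.AlgebraicComplexity

namespace SahaThankey2021

variable (F : Type*) [Field F] {n : ℕ}

/-! ### Defs 1, 2: (commutative) ROABPs, as printed -/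

/-- **ST Def. 1 (ROABP)** (p. 50:3 L7–10): "An `n`-variate, width-`w` read-once oblivious algebraic
branching program (ROABP) is a product of the form `1ᵀ · M₁(x₁) M₂(x₂) ⋯ M_n(x_n) · 1`, where `1` is
the `w × 1` vector of all ones, and for every `i ∈ [n]`, `Mᵢ(xᵢ)` is a `w × w` matrix whose entries
are in `F[xᵢ]`." `f` is computed by such a program: `f = ∑_{a,b} (M₁⋯M_n)_{a,b}`.
[cite: SahaThankey2021, Def. 1 (p. 50:3)] -/
def IsROABP (w : ℕ) (f : MvPolynomial (Fin n) F) : Prop :=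
  ∃ M : Fin n → Matrix (Fin w) (Fin w) (MvPolynomial (Fin n) F),
    (∀ i a b, ∃ p : Polynomial F, M i a b = Polynomial.aeval (X i : MvPolynomial (Fin n) F) p) ∧
    f = ∑ a : Fin w, ∑ b : Fin w, (List.ofFn M).prod a b

/-- **ST Def. 2 (Commutative ROABP)** (p. 50:3 L11–13): "An `n`-variate, width-`w` commutative
ROABP is an `n`-variate, width-`w` ROABP `1ᵀ · M₁(x₁) M₂(x₂) ⋯ M_n(x_n) · 1`, where for all
`i, j ∈ [n]`, `Mᵢ(xᵢ)` and `Mⱼ(xⱼ)` commute with each other." (NOT the tree's FSV notion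
`IsCommROABP` = "computable in every order"; see the module docstring.)
[cite: SahaThankey2021, Def. 2 (p. 50:3)] -/
def IsCommutativeROABP (w : ℕ) (f : MvPolynomial (Fin n) F) : Prop :=
  ∃ M : Fin n → Matrix (Fin w) (Fin w) (MvPolynomial (Fin n) F),
    (∀ i a b, ∃ p : Polynomial F, M i a b = Polynomial.aeval (X i : MvPolynomial (Fin n) F) p) ∧
    (∀ i j, M i * M j = M j * M i) ∧
    f = ∑ a : Fin w, ∑ b : Fin w, (List.ofFn M).prod a b

/-- A commutative ROABP is an ROABP. [cite: SahaThankey2021, Def. 2 (p. 50:3)] -/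
theorem IsCommutativeROABP.isROABP {w : ℕ} {f : MvPolynomial (Fin n) F}
    (h : IsCommutativeROABP F w f) : IsROABP F w f := by
  obtain ⟨M, hM, -, hf⟩ := h
  exact ⟨M, hM, hf⟩

/-! ### Def 3: occur-`k` formulas -/

/-- **ST Def. 3 (occur-`k` formulas)** (p. 50:3 L17–27), the underlying syntax: "a rooted tree whose
leaves are labelled by `s`-sparse polynomials and whose internal nodes are sum (`+`) gates or
product-power (`×⋏`) gates … The edges feeding into a `+` gate are labelled by field elements …
the edges feeding into a `×⋏` gate have natural numbers as edge weights." A `+` gate with children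
`g₁,…,g_k` and labels `α` computes `∑ αᵢ gᵢ`; a `×⋏` gate with weights `e` computes `∏ gᵢ^{eᵢ}`.
[cite: SahaThankey2021, Def. 3 (p. 50:3)] -/
inductive Formula (F : Type*) [Field F] (n : ℕ) : Type _
  | leaf (p : MvPolynomial (Fin n) F) : Formula F n
  | add (k : ℕ) (α : Fin k → F) (g : Fin k → Formula F n) : Formula F n
  | mulPow (k : ℕ) (e : Fin k → ℕ) (g : Fin k → Formula F n) : Formula F n

namespace Formula

variable {F}

/-- The polynomial computed by a formula (Def. 3: "A leaf node computes the `s`-sparse polynomial that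
labels it. A `+` gate … computes `α₁f₁ + ⋯ + α_m f_m`. A `×⋏` gate … computes `f₁^{e₁} ⋯ f_m^{e_m}`.")
[cite: SahaThankey2021, Def. 3 (p. 50:3)] -/
def eval : Formula F n → MvPolynomial (Fin n) F
  | leaf p => p
  | add k α g => ∑ i : Fin k, α i • eval (g i)
  | mulPow k e g => ∏ i : Fin k, eval (g i) ^ e i

/-- The depth (Def. 3: "the depth of the underlying tree plus `2`, to account for the depth of the
circuits computing the sparse polynomials at the leaves"; a leaf has tree depth `0`).
[cite: SahaThankey2021, Def. 3 (p. 50:3)] -/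
def depth : Formula F n → ℕ
  | leaf _ => 2
  | add k _ g => (Finset.univ.sup fun i : Fin k => depth (g i)) + 1
  | mulPow k _ g => (Finset.univ.sup fun i : Fin k => depth (g i)) + 1

/-- The size (Def. 3: "the weighted sum of all the edges in it (i.e., an edge is counted as many
times as its edge weight) plus the sizes of the depth-2 circuits computing the `s`-sparse polynomials
at the leaves"; a leaf `p` is charged `#monomials(p) · (deg p + 1)`, the size of a `ΣΠ` circuit for
it — p. 50:3 L15 "a degree-`d` `s`-sparse polynomial can be computed by a depth-2 circuit of size
`sd`"; edges into a `+` gate have weight `1`). [cite: SahaThankey2021, Def. 3 (p. 50:3)] -/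
def size : Formula F n → ℕ
  | leaf p => p.support.card * (p.totalDegree + 1)
  | add k _ g => ∑ i : Fin k, (size (g i) + 1)
  | mulPow k e g => ∑ i : Fin k, (size (g i) + e i)

/-- The number of leaves in which the variable `xᵢ` appears (Def. 3: "Each variable appears in at
most `k` of the sparse polynomials that label the leaves"). [cite: SahaThankey2021, Def. 3 (p. 50:3)] -/
def occur (i : Fin n) : Formula F n → ℕ
  | leaf p => if p.degreeOf i = 0 then 0 else 1
  | add k _ g => ∑ j : Fin k, occur i (g j)
  | mulPow k _ g => ∑ j : Fin k, occur i (g j)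

/-- Every leaf is `s`-sparse (at most `s` monomials). [cite: SahaThankey2021, Def. 3 (p. 50:3)] -/
def LeavesSparse (s : ℕ) : Formula F n → Prop
  | leaf p => p.support.card ≤ s
  | add k _ g => ∀ j : Fin k, LeavesSparse s (g j)
  | mulPow k _ g => ∀ j : Fin k, LeavesSparse s (g j)

/-- Every leaf is `b`-variate (involves at most `b` variables; Thms 9/10 "If the leaves are labelled
by `b`-variate polynomials"). [cite: SahaThankey2021, Thm. 9 (p. 50:5)] -/
def LeavesVariate (b : ℕ) : Formula F n → Prop
  | leaf p => p.vars.card ≤ b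
  | add k _ g => ∀ j : Fin k, LeavesVariate b (g j)
  | mulPow k _ g => ∀ j : Fin k, LeavesVariate b (g j)

end Formula

/-- **Occur-`k`**: every variable appears in at most `k` leaves (Def. 3). [cite: SahaThankey2021, Def. 3 (p. 50:3)] -/
def Formula.IsOccur {F : Type*} [Field F] {n : ℕ} (k : ℕ) (φ : Formula F n) : Prop :=
  ∀ i : Fin n, φ.occur i ≤ k

/-! ### Defs 4, 5: orbits (over the tree's `MS2021.linOrbit`) and hitting sets (tree) -/

/-- **ST Def. 4 (orbits)** (p. 50:3 L42–44): "The orbit of `f`, denoted by `orb(f)`, is the set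
`{f(Ax) : A ∈ GL(n, F)}`. The orbit of a set of polynomials `C`, denoted by `orb(C)`, is the union of
the orbits of the polynomials in `C`." The orbit of one polynomial is the tree's `MS2021.linOrbit n f`
(Medini–Shpilka's `f^{GL_n(F)}`, `x_i ↦ (Ax)_i`). [cite: SahaThankey2021, Def. 4 (p. 50:3)] -/
def orb (𝒞 : Set (MvPolynomial (Fin n) F)) : Set (MvPolynomial (Fin n) F) :=
  ⋃ f ∈ 𝒞, MS2021.linOrbit n f

/-- Membership in `orb(C)`. [cite: SahaThankey2021, Def. 4 (p. 50:3)] -/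
theorem mem_orb_iff {𝒞 : Set (MvPolynomial (Fin n) F)} {g : MvPolynomial (Fin n) F} :
    g ∈ orb F 𝒞 ↔ ∃ f ∈ 𝒞, g ∈ MS2021.linOrbit n f := by
  simp only [orb, Set.mem_iUnion, exists_prop]

end SahaThankey2021

/-! ### §1.2: Theorems 6, 8, 9, 10 (named facts; Thm. 7 = the tree's `MS2021_cor_44`) -/

section Facts

open SahaThankey2021 HittingSets

/-- **ST Thm. 6 (hitting sets for the orbits of commutative ROABPs with low individual degree)**
(p. 50:4 L18–21): "Let `C` be the set of `n`-variate polynomials with individual degree at most `d`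
that are computable by width-`w` commutative ROABPs. If `|F| > n²d`, then a hitting set for `orb(C)`
can be computed in `(nd)^{O(d log w)}` time." Typed: existence of a hitting set of that size (one
absolute constant `c`; explicitness dropped — WEAKER). [cite: SahaThankey2021, Thm. 6 (p. 50:4)] -/
def sahaThankey2021_thm_6 : Prop :=
  ∃ c : ℕ, ∀ (F : Type) [Field F] (n d w : ℕ), (Infinite F ∨ n ^ 2 * d < Nat.card F) →
    ∃ H : Finset (Fin n → F), H.card ≤ (n * d) ^ (c * d * (Nat.log 2 w + 1)) + c ∧
      IsHittingSetFor (↑H) (orb F {f : MvPolynomial (Fin n) F |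
        (∀ i, f.degreeOf i ≤ d) ∧ IsCommutativeROABP F w f})

/-- **ST Thm. 8 (hitting sets for the orbits of multilinear constant-width ROABPs)** (p. 50:4
L45–47): "Let `C` be the set of `n`-variate multilinear polynomials that are computable by width-`w`
ROABPs. If `|F| > n^{O(w⁴)}`, then a hitting set for `orb(C)` can be computed in `n^{O(w⁶·log n)}`
time." Typed with one constant `c` for both `O(·)`; existence/size for time (WEAKER).
[cite: SahaThankey2021, Thm. 8 (p. 50:4)] -/
def sahaThankey2021_thm_8 : Prop :=
  ∃ c : ℕ, ∀ (F : Type) [Field F] (n w : ℕ), (Infinite F ∨ n ^ (c * w ^ 4) < Nat.card F) →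
    ∃ H : Finset (Fin n → F), H.card ≤ n ^ (c * w ^ 6 * (Nat.log 2 n + 1)) + c ∧
      IsHittingSetFor (↑H) (orb F {f : MvPolynomial (Fin n) F |
        (∀ i, f.degreeOf i ≤ 1) ∧ IsROABP F w f})

/-- **ST Thm. 9 (hitting sets for the orbits of constant-depth, constant-occur formulas)** (p. 50:5
L9–16): "Let `C` be the set of `n`-variate, degree-`D` polynomials that are computable by depth-`Δ`,
occur-`k` formulas of size `s`. Let `R := (2k)^{2Δ·2^Δ}`. If `char(F) = 0` or `> (2ks)^{Δ³R}`, then a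
hitting set for `orb(C)` can be computed in `(nRD)^{O(R(log R + Δ log k + Δ log s) + ΔR)}` time. If
the leaves are labelled by `b`-variate polynomials, then a hitting set for `orb(C)` can be computed in
`(nRD)^{O(Rb + ΔR)}` time." (The "in particular" clause for constant `Δ, k` is a specialization.)
Typed: existence/size for time (WEAKER), one constant per bound, classes with `≤`.
[cite: SahaThankey2021, Thm. 9 (p. 50:5)] -/
def sahaThankey2021_thm_9 : Prop :=
  ∃ c : ℕ, ∀ (F : Type) [Field F] (n D Δ k s : ℕ),
    (ringChar F = 0 ∨ (2 * k * s) ^ (Δ ^ 3 * (2 * k) ^ (2 * Δ * 2 ^ Δ)) < ringChar F) →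
    (∃ H : Finset (Fin n → F),
      H.card ≤ (n * (2 * k) ^ (2 * Δ * 2 ^ Δ) * D) ^
        (c * ((2 * k) ^ (2 * Δ * 2 ^ Δ) *
          (Nat.log 2 ((2 * k) ^ (2 * Δ * 2 ^ Δ)) + Δ * Nat.log 2 k + Δ * Nat.log 2 s + 1) +
          Δ * (2 * k) ^ (2 * Δ * 2 ^ Δ))) + c ∧
      IsHittingSetFor (↑H) (orb F {f : MvPolynomial (Fin n) F | f.totalDegree ≤ D ∧
        ∃ φ : Formula F n, φ.depth ≤ Δ ∧ φ.IsOccur k ∧ φ.size ≤ s ∧ φ.eval = f})) ∧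
    ∀ b : ℕ, ∃ H : Finset (Fin n → F),
      H.card ≤ (n * (2 * k) ^ (2 * Δ * 2 ^ Δ) * D) ^
        (c * ((2 * k) ^ (2 * Δ * 2 ^ Δ) * b + Δ * (2 * k) ^ (2 * Δ * 2 ^ Δ) + 1)) + c ∧
      IsHittingSetFor (↑H) (orb F {f : MvPolynomial (Fin n) F | f.totalDegree ≤ D ∧
        ∃ φ : Formula F n, φ.depth ≤ Δ ∧ φ.IsOccur k ∧ φ.size ≤ s ∧ φ.LeavesVariate b ∧ φ.eval = f})

/-- **ST Thm. 10 (hitting sets for the orbits of occur-once formulas)** (p. 50:5 L27–31): "Let `C`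
be the set of `n`-variate, degree-`D` polynomials that are computable by occur-once formulas whose
leaves are labelled by `s`-sparse polynomials. If `|F| > nD` and `char(F) = 0` or `> D`, then a
hitting set for `orb(C)` can be computed in `(nD)^{O(log n + log s)}` time. If the leaves are labelled
by `b`-variate polynomials, then a hitting set for `orb(C)` can be computed in `(nD)^{O(log n + b)}`
time." (The paper's Thm. 7, used in the proof, is Medini–Shpilka's theorem = the tree's
`MS2021_cor_44`.) Typed: existence/size for time (WEAKER), one constant per bound.
[cite: SahaThankey2021, Thm. 10 (p. 50:5)] -/
def sahaThankey2021_thm_10 : Prop :=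
  ∃ c : ℕ, ∀ (F : Type) [Field F] (n D s : ℕ), (Infinite F ∨ n * D < Nat.card F) →
    (ringChar F = 0 ∨ D < ringChar F) →
    (∃ H : Finset (Fin n → F), H.card ≤ (n * D) ^ (c * (Nat.log 2 n + Nat.log 2 s + 1)) + c ∧
      IsHittingSetFor (↑H) (orb F {f : MvPolynomial (Fin n) F | f.totalDegree ≤ D ∧
        ∃ φ : Formula F n, φ.IsOccur 1 ∧ φ.LeavesSparse s ∧ φ.eval = f})) ∧
    ∀ b : ℕ, ∃ H : Finset (Fin n → F), H.card ≤ (n * D) ^ (c * (Nat.log 2 n + b + 1)) + c ∧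
      IsHittingSetFor (↑H) (orb F {f : MvPolynomial (Fin n) F | f.totalDegree ≤ D ∧
        ∃ φ : Formula F n, φ.IsOccur 1 ∧ φ.LeavesSparse s ∧ φ.LeavesVariate b ∧ φ.eval = f})

end Facts

end Literature.Computability.AlgebraicComplexity

end
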